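import Mathlib
import Literature.NumberTheory.Transcendental.SemialgebraicMapsProofs
import Literature.NumberTheory.Transcendental.SemialgebraicVolume
import Literature.ModelTheory.ExponentialFields.SemialgebraicInterior

/-!
# Crux `SymplecticScissors.PlanarSAZylev` (stmt-KontsevichZagierPeriods-9848),
line `reservoir-peeling`, stub `stub_teGlue`: gluing two instances of the pseudogroup equivalence

The pinned relation `E A B` says: an open co-null `ℚ`-semialgebraic part `U` of `A` is carried by
one `ℚ`-semialgebraic `C¹` injection `Φ` with `|det DΦ| = 1` onto a co-null part of `B`.  We prove
that two instances `E A₁ B₁`, `E A₂ B₂` with a.e.-disjoint sources (`volume (A₁ ∩ A₂) = 0`) and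
disjoint targets glue to an instance `E (A₁ ∪ A₂) (B₁ ∪ B₂)`.

From witnesses `(U₁, Φ₁)` and `(U₂, Φ₂)`: the open set `U₁ ∩ U₂ ⊆ A₁ ∩ A₂` is null, hence EMPTY
(`IsOpen.eq_empty_of_measure_zero`, Lebesgue measure charges open sets), so the glued map
`Φ := U₁.piecewise Φ₁ Φ₂` agrees with `Φ₁` on `U₁` and with `Φ₂` on `U₂`.  On `U := U₁ ∪ U₂` it is
`ℚ`-semialgebraic (its graph is the union of the two graphs, `teGlue_isSemialgebraicMapOn_union`),
`C¹` (a local property, `contDiffOn_of_locally_contDiffOn`), injective (the targets `B₁ ⊇ Φ₁ '' U₁`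
and `B₂ ⊇ Φ₂ '' U₂` are disjoint), has `|det DΦ| = 1` (the derivative is local,
`Filter.EventuallyEq.fderiv_eq`), and `Φ '' U = Φ₁ '' U₁ ∪ Φ₂ '' U₂` is co-null in `B₁ ∪ B₂`.

Sources: folklore bookkeeping; Bochnak–Coste–Roy 1998, §2.2 (semialgebraic maps).  No new
definitions.
-/

noncomputable section

open MeasureTheory Set
open Literature.NumberTheory.Transcendental Literature.ModelTheory.ExponentialFields

namespace Summit.KontsevichZagierPeriods.SymplecticScissors.PlanarSAZylev

/-- **Union of semialgebraic maps.** If `f` is `ℚ`-semialgebraic on `s` and on `t`, then it is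
`ℚ`-semialgebraic on `s ∪ t`: the graph over `s ∪ t` is the union of the graphs over `s` and `t`
(Bochnak–Coste–Roy 1998, §2.2). [folklore] -/
theorem teGlue_isSemialgebraicMapOn_union {m n : ℕ} {s t : Set (Fin m → ℝ)}
    {f : (Fin m → ℝ) → (Fin n → ℝ)} (hs : IsSemialgebraicMapOn ℚ s f)
    (ht : IsSemialgebraicMapOn ℚ t f) : IsSemialgebraicMapOn ℚ (s ∪ t) f := by
  unfold IsSemialgebraicMapOn at hs ht ⊢
  convert hs.union ht using 1
  ext z
  simp only [mem_setOf_eq, mem_union]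
  constructor
  · rintro ⟨x, hx | hx, rfl⟩
    · exact Or.inl ⟨x, hx, rfl⟩
    · exact Or.inr ⟨x, hx, rfl⟩
  · rintro (⟨x, hx, rfl⟩ | ⟨x, hx, rfl⟩)
    · exact ⟨x, Or.inl hx, rfl⟩
    · exact ⟨x, Or.inr hx, rfl⟩

/-- **Open parts of a.e.-disjoint sets are disjoint.** If `U₁ ⊆ A₁`, `U₂ ⊆ A₂` are open and
`A₁ ∩ A₂` is Lebesgue-null, then `U₁ ∩ U₂` is an open null set, hence empty (Lebesgue measure on
`ℝ²` charges every nonempty open set). [folklore] -/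
theorem teGlue_disjoint {A₁ A₂ U₁ U₂ : Set (Fin 2 → ℝ)} (hUA₁ : U₁ ⊆ A₁) (hUA₂ : U₂ ⊆ A₂)
    (hU₁o : IsOpen U₁) (hU₂o : IsOpen U₂) (hA : volume (A₁ ∩ A₂) = 0) : Disjoint U₁ U₂ := by
  rw [Set.disjoint_iff_inter_eq_empty]
  exact (hU₁o.inter hU₂o).eq_empty_of_measure_zero
    (measure_mono_null (inter_subset_inter hUA₁ hUA₂) hA)

/-- **Co-null parts of a union.** If `U₁` is co-null in `A₁` and `U₂` is co-null in `A₂`, then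
`U₁ ∪ U₂` is co-null in `A₁ ∪ A₂`, since `(A₁ ∪ A₂) \ (U₁ ∪ U₂) ⊆ (A₁ \ U₁) ∪ (A₂ \ U₂)`.
[folklore] -/
theorem teGlue_union_diff_union_null {A₁ A₂ U₁ U₂ : Set (Fin 2 → ℝ)}
    (hAU₁ : volume (A₁ \ U₁) = 0) (hAU₂ : volume (A₂ \ U₂) = 0) :
    volume ((A₁ ∪ A₂) \ (U₁ ∪ U₂)) = 0 := by
  refine measure_mono_null (fun x hx => ?_) (measure_union_null hAU₁ hAU₂)
  rcases hx.1 with h1 | h2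
  · exact Or.inl ⟨h1, fun h => hx.2 (Or.inl h)⟩
  · exact Or.inr ⟨h2, fun h => hx.2 (Or.inr h)⟩

/-- **Gluing of witnesses.** Let `(U₁, Φ₁)` witness `E A₁ B₁` and `(U₂, Φ₂)` witness `E A₂ B₂`,
with `U₁`, `U₂` disjoint and `B₁`, `B₂` disjoint, and let `Φ` agree with `Φ₁` on `U₁` and with
`Φ₂` on `U₂`.  Then `(U₁ ∪ U₂, Φ)` witnesses `E (A₁ ∪ A₂) (B₁ ∪ B₂)`: semialgebraicity of the
graph is a union, `C¹` and the Jacobian condition are local on the open pieces, injectivity holds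
because the two images lie in the disjoint sets `B₁`, `B₂`, and the missed parts of source and
target are unions of two null sets. [folklore] -/
theorem teGlue_glue {A₁ A₂ B₁ B₂ U₁ U₂ : Set (Fin 2 → ℝ)} {Φ₁ Φ₂ Φ : (Fin 2 → ℝ) → (Fin 2 → ℝ)}
    (hUA₁ : U₁ ⊆ A₁) (hU₁sa : IsSemialgebraic ℚ U₁) (hU₁o : IsOpen U₁)
    (hAU₁ : volume (A₁ \ U₁) = 0) (hΦ₁sa : IsSemialgebraicMapOn ℚ U₁ Φ₁)
    (hΦ₁C1 : ContDiffOn ℝ 1 Φ₁ U₁) (hinj₁ : InjOn Φ₁ U₁)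
    (hdet₁ : ∀ p ∈ U₁, |(fderiv ℝ Φ₁ p).det| = 1) (hΦB₁ : Φ₁ '' U₁ ⊆ B₁)
    (hBΦ₁ : volume (B₁ \ Φ₁ '' U₁) = 0)
    (hUA₂ : U₂ ⊆ A₂) (hU₂sa : IsSemialgebraic ℚ U₂) (hU₂o : IsOpen U₂)
    (hAU₂ : volume (A₂ \ U₂) = 0) (hΦ₂sa : IsSemialgebraicMapOn ℚ U₂ Φ₂)
    (hΦ₂C1 : ContDiffOn ℝ 1 Φ₂ U₂) (hinj₂ : InjOn Φ₂ U₂)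
    (hdet₂ : ∀ p ∈ U₂, |(fderiv ℝ Φ₂ p).det| = 1) (hΦB₂ : Φ₂ '' U₂ ⊆ B₂)
    (hBΦ₂ : volume (B₂ \ Φ₂ '' U₂) = 0)
    (hB : Disjoint B₁ B₂) (heq₁ : EqOn Φ Φ₁ U₁) (heq₂ : EqOn Φ Φ₂ U₂) :
    U₁ ∪ U₂ ⊆ A₁ ∪ A₂ ∧ IsSemialgebraic ℚ (U₁ ∪ U₂) ∧ IsOpen (U₁ ∪ U₂) ∧
      volume ((A₁ ∪ A₂) \ (U₁ ∪ U₂)) = 0 ∧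
      IsSemialgebraicMapOn ℚ (U₁ ∪ U₂) Φ ∧ ContDiffOn ℝ 1 Φ (U₁ ∪ U₂) ∧ InjOn Φ (U₁ ∪ U₂) ∧
      (∀ p ∈ U₁ ∪ U₂, |(fderiv ℝ Φ p).det| = 1) ∧ Φ '' (U₁ ∪ U₂) ⊆ B₁ ∪ B₂ ∧
      volume ((B₁ ∪ B₂) \ Φ '' (U₁ ∪ U₂)) = 0 := by
  have himage : Φ '' (U₁ ∪ U₂) = Φ₁ '' U₁ ∪ Φ₂ '' U₂ := by
    rw [image_union, heq₁.image_eq, heq₂.image_eq]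
  refine ⟨union_subset_union hUA₁ hUA₂, hU₁sa.union hU₂sa, hU₁o.union hU₂o,
    teGlue_union_diff_union_null hAU₁ hAU₂,
    teGlue_isSemialgebraicMapOn_union (hΦ₁sa.congr heq₁.symm) (hΦ₂sa.congr heq₂.symm),
    ?_, ?_, ?_, ?_, ?_⟩
  · -- `C¹` is a local property: near a point of `Uᵢ` the glued map is `Φᵢ`
    refine contDiffOn_of_locally_contDiffOn fun x hx => ?_
    rcases hx with hx | hx
    · exact ⟨U₁, hU₁o, hx, (hΦ₁C1.congr heq₁).mono inter_subset_right⟩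
    · exact ⟨U₂, hU₂o, hx, (hΦ₂C1.congr heq₂).mono inter_subset_right⟩
  · -- injectivity: within a piece by `hinjᵢ`, across pieces the values lie in `B₁` resp. `B₂`
    intro x hx y hy hxy
    rcases hx with hx | hx <;> rcases hy with hy | hy
    · exact hinj₁ hx hy (by rw [← heq₁ hx, ← heq₁ hy, hxy])
    · exact absurd (heq₂ hy ▸ heq₁ hx ▸ hxy : Φ₁ x = Φ₂ y) fun h =>
        Set.disjoint_left.1 hB (hΦB₁ ⟨x, hx, rfl⟩) (h ▸ hΦB₂ ⟨y, hy, rfl⟩)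
    · exact absurd (heq₁ hy ▸ heq₂ hx ▸ hxy : Φ₂ x = Φ₁ y) fun h =>
        Set.disjoint_left.1 hB (hΦB₁ ⟨y, hy, rfl⟩) (h.symm ▸ hΦB₂ ⟨x, hx, rfl⟩)
    · exact hinj₂ hx hy (by rw [← heq₂ hx, ← heq₂ hy, hxy])
  · -- the derivative is local
    intro p hp
    rcases hp with hp | hp
    · rw [(heq₁.eventuallyEq_of_mem (hU₁o.mem_nhds hp)).fderiv_eq]
      exact hdet₁ p hp
    · rw [(heq₂.eventuallyEq_of_mem (hU₂o.mem_nhds hp)).fderiv_eq]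
      exact hdet₂ p hp
  · rw [himage]
    exact union_subset_union hΦB₁ hΦB₂
  · rw [himage]
    exact teGlue_union_diff_union_null hBΦ₁ hBΦ₂

/-- **Gluing** (stub `stub_teGlue` of crux `SymplecticScissors.PlanarSAZylev`, line
`reservoir-peeling`): two instances of the pinned relation `E` with a.e.-disjoint sources (their
open parts are then disjoint, an open null set being empty) and disjoint targets glue to one
instance on the union, the glued map being `U₁.piecewise Φ₁ Φ₂`. [folklore] -/
theorem stub_teGlue :
    ∀ (E : Set (Fin 2 → ℝ) → Set (Fin 2 → ℝ) → Prop),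
      (∀ A B : Set (Fin 2 → ℝ), E A B ↔
        ∃ (U : Set (Fin 2 → ℝ)) (Φ : (Fin 2 → ℝ) → (Fin 2 → ℝ)),
          U ⊆ A ∧ IsSemialgebraic ℚ U ∧ IsOpen U ∧ volume (A \ U) = 0 ∧
          IsSemialgebraicMapOn ℚ U Φ ∧ ContDiffOn ℝ 1 Φ U ∧ InjOn Φ U ∧
          (∀ p ∈ U, |(fderiv ℝ Φ p).det| = 1) ∧ Φ '' U ⊆ B ∧ volume (B \ Φ '' U) = 0) →
    ∀ A₁ A₂ B₁ B₂ : Set (Fin 2 → ℝ), volume (A₁ ∩ A₂) = 0 → Disjoint B₁ B₂ →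
      E A₁ B₁ → E A₂ B₂ → E (A₁ ∪ A₂) (B₁ ∪ B₂) := by
  intro E HE A₁ A₂ B₁ B₂ hA hB h₁ h₂
  classical
  obtain ⟨U₁, Φ₁, hUA₁, hU₁sa, hU₁o, hAU₁, hΦ₁sa, hΦ₁C1, hinj₁, hdet₁, hΦB₁, hBΦ₁⟩ :=
    (HE A₁ B₁).1 h₁
  obtain ⟨U₂, Φ₂, hUA₂, hU₂sa, hU₂o, hAU₂, hΦ₂sa, hΦ₂C1, hinj₂, hdet₂, hΦB₂, hBΦ₂⟩ :=
    (HE A₂ B₂).1 h₂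
  have hdisj : Disjoint U₁ U₂ := teGlue_disjoint hUA₁ hUA₂ hU₁o hU₂o hA
  have heq₁ : EqOn (U₁.piecewise Φ₁ Φ₂) Φ₁ U₁ := Set.piecewise_eqOn U₁ Φ₁ Φ₂
  have heq₂ : EqOn (U₁.piecewise Φ₁ Φ₂) Φ₂ U₂ :=
    (Set.piecewise_eqOn_compl U₁ Φ₁ Φ₂).mono fun x hx hx₁ => Set.disjoint_left.1 hdisj hx₁ hx
  exact (HE (A₁ ∪ A₂) (B₁ ∪ B₂)).2 ⟨U₁ ∪ U₂, U₁.piecewise Φ₁ Φ₂,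
    teGlue_glue hUA₁ hU₁sa hU₁o hAU₁ hΦ₁sa hΦ₁C1 hinj₁ hdet₁ hΦB₁ hBΦ₁ hUA₂ hU₂sa hU₂o hAU₂
      hΦ₂sa hΦ₂C1 hinj₂ hdet₂ hΦB₂ hBΦ₂ hB heq₁ heq₂⟩

end Summit.KontsevichZagierPeriods.SymplecticScissors.PlanarSAZylev
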